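import Summits.ValiantsHypothesis.ValiantsHypothesis.Theorems.LacunarySymmetroidMatrixDescartesDoorA26NullEndPerturbation

/-!
# `DoorA26`, negative side — ONE MORE ALTERNATION at each end of a `(2,6)` pencil with a NULL end letter

HONEST FRAMING.  Helper theorems (def-free, `--supports 19979 --as helper`) for the negative-side file `Theorems/DoorA26/Negative/DoorA26FalseOfNullNullEighteen.lean` (crux stmt-ValiantsHypothesis-19979
`DoorA26`; OPEN, typed, never asserted); W2 seat val-sym-door-p1 g16.  `extend_top`: if the top letter is null and non-zero (`det S₅ = 0 ≠ tr S₅`), the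
exponents are strictly increasing and `det P` takes non-zero values of alternating sign at `N+1` increasing positive abscissae, then for a suitable small
`η` the pencil with `S₅ + η·1` has `N+2` such abscissae (the old ones, signs preserved by continuity, and a far-right one whose sign is that of
`det(S₅ + η·1) = η·tr S₅ + η²`, chosen opposite to the last old sign).  `extend_bot`: the same at the bottom letter with a new abscissa near `0⁺`.
Nothing here bears on `DoorA26`, `MatrixDescartes` (stmt-ValiantsHypothesis-18050) or `VP ≠ VNP`.

[folklore] continuity + leading terms; [this work] the bookkeeping.
-/

-- `Summit.ValiantsHypothesis.ValiantsHypothesis.…` repeats a component by the D-0017 layout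
-- (single-conjunct summit), which the `dupNamespace` linter flags; the name is mandated.
set_option linter.dupNamespace false

namespace Summit.ValiantsHypothesis.ValiantsHypothesis.Theorems.LacunarySymmetroidMatrixDescartes.NullEnd

open Polynomial Finset Filter Topology
open scoped BigOperators Matrix
open Summit.ValiantsHypothesis.ValiantsHypothesis.Theorems.SymmetroidDescartes (eval_det_pencil le_card_posRoots_of_alternating)
open Summit.ValiantsHypothesis.ValiantsHypothesis.Theorems.LacunarySymmetroidMatrixDescartes.WallBubbling.Bubbling
  (polar polar_self det_sum_smul_fin_two)

/-! ### One more alternation at the TOP (un-null the highest letter) -/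

/-- **Top extension.**  Null non-zero top letter, strictly increasing exponents, `N+1` alternating abscissae with non-vanishing values ⇒ after replacing
`S₅` by `S₅ + η·1` for a suitable small `η`, there are `N+2` alternating abscissae (the old ones and one more on the right). [this work] -/
theorem extend_top (d : Fin 6 → ℕ) (hd : StrictMono d) (S : Fin 6 → Matrix (Fin 2) (Fin 2) ℝ)
    (h5 : (S 5).det = 0) (htr : (S 5).trace ≠ 0) {N : ℕ} (τ : Fin (N + 1) → ℝ) (hτ : StrictMono τ) (hpos : ∀ j, 0 < τ j)
    (hne : ∀ j, (∑ l, τ j ^ d l • S l).det ≠ 0)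
    (halt : ∀ j : Fin N, (∑ l, τ j.castSucc ^ d l • S l).det * (∑ l, τ j.succ ^ d l • S l).det < 0) :
    ∃ (η : ℝ) (τ' : Fin (N + 2) → ℝ), StrictMono τ' ∧ (∀ j, 0 < τ' j) ∧
      (∀ j, (∑ l, τ' j ^ d l • Function.update S 5 (S 5 + η • (1 : Matrix (Fin 2) (Fin 2) ℝ)) l).det ≠ 0) ∧
      (∀ j : Fin (N + 1),
        (∑ l, τ' j.castSucc ^ d l • Function.update S 5 (S 5 + η • (1 : Matrix (Fin 2) (Fin 2) ℝ)) l).det *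
        (∑ l, τ' j.succ ^ d l • Function.update S 5 (S 5 + η • (1 : Matrix (Fin 2) (Fin 2) ℝ)) l).det < 0) := by
  -- notation
  set f : (Fin 6 → Matrix (Fin 2) (Fin 2) ℝ) → ℝ → ℝ := fun T t => (∑ l, t ^ d l • T l).det with hf
  set U : ℝ → Fin 6 → Matrix (Fin 2) (Fin 2) ℝ := fun η => Function.update S 5 (S 5 + η • (1 : Matrix (Fin 2) (Fin 2) ℝ)) with hU
  set aL : ℝ := f S (τ (Fin.last N)) with haL
  have haL0 : aL ≠ 0 := hne _
  -- the perturbation size `η_s = −s·(tr S₅ · aL)`, `s → 0⁺`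
  set ηof : ℝ → ℝ := fun s => -(s * ((S 5).trace * aL)) with hηof
  have hη0 : Tendsto ηof (𝓝[>] 0) (𝓝 0) := by
    have : Tendsto ηof (𝓝 0) (𝓝 (ηof 0)) := by
      have hc : Continuous ηof := by rw [hηof]; fun_prop
      exact hc.tendsto 0
    rw [show ηof 0 = 0 by simp [hηof]] at this
    exact this.mono_left nhdsWithin_le_nhds
  -- (i) persistence of the N+1 signs
  have hpers : ∀ j, ∀ᶠ s in 𝓝[>] (0 : ℝ), 0 < f S (τ j) * f (U (ηof s)) (τ j) := by
    intro j
    have hc : Tendsto (fun η => f (U η) (τ j)) (𝓝 0) (𝓝 (f (U 0) (τ j))) :=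
      (continuous_det_pencil_update d S 5 (τ j)).tendsto 0
    have hU0 : f (U 0) (τ j) = f S (τ j) := by
      simp [hU, hf]
    rw [hU0] at hc
    have h2 : Tendsto (fun s => f S (τ j) * f (U (ηof s)) (τ j)) (𝓝[>] 0) (𝓝 (f S (τ j) * f S (τ j))) :=
      ((hc.comp (hη0)).const_mul _)
    exact h2.eventually (lt_mem_nhds (mul_self_pos.mpr (hne j)))
  -- (ii) the new top sign: det(S₅ + η·1)·aL < 0
  have hnew : ∀ᶠ s in 𝓝[>] (0 : ℝ), (U (ηof s) 5).det * aL < 0 := by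
    have hdet : ∀ s, (U (ηof s) 5).det * aL = s * (-( ((S 5).trace * aL) ^ 2) + s * (((S 5).trace * aL) ^ 2 * aL)) := by
      intro s
      simp only [hU, Function.update_self, LacunarySymmetroidMatrixDescartes.TailGraft.det_add_smul_one_two, h5, hηof]
      ring
    simp_rw [hdet]
    have hq : Tendsto (fun s : ℝ => -( ((S 5).trace * aL) ^ 2) + s * (((S 5).trace * aL) ^ 2 * aL)) (𝓝[>] 0)
        (𝓝 (-( ((S 5).trace * aL) ^ 2) + 0 * (((S 5).trace * aL) ^ 2 * aL))) := by
      have hc : Continuous (fun s : ℝ => -( ((S 5).trace * aL) ^ 2) + s * (((S 5).trace * aL) ^ 2 * aL)) := by fun_prop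
      exact (hc.tendsto 0).mono_left nhdsWithin_le_nhds
    have hlim : -( ((S 5).trace * aL) ^ 2) + 0 * (((S 5).trace * aL) ^ 2 * aL) < 0 := by
      have : 0 < ((S 5).trace * aL) ^ 2 := by positivity
      linarith
    have hev := hq.eventually (gt_mem_nhds hlim)
    filter_upwards [hev, self_mem_nhdsWithin] with s hs hs0
    exact mul_neg_of_pos_of_neg hs0 hs
  -- choose `s`
  obtain ⟨s, hs_pers, hs_new⟩ := (((Finset.eventually_all Finset.univ).mpr fun j _ => hpers j).and hnew).exists
  set η := ηof s with hηdef
  have hpers' : ∀ j, 0 < f S (τ j) * f (U η) (τ j) := fun j => hs_pers j (Finset.mem_univ j)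
  have hD0 : (U η 5).det ≠ 0 := by
    intro h0; rw [h0, zero_mul] at hs_new; exact lt_irrefl _ hs_new
  -- (iii) a far-right abscissa with the sign of det(U η 5)
  have htop := tendsto_det_pencil_div_top d hd (U η)
  have hev1 : ∀ᶠ x in atTop, 0 < f (U η) x * (U η 5).det := by
    have h1 : Tendsto (fun x : ℝ => (f (U η) x / x ^ (2 * d 5)) * (U η 5).det) atTop (𝓝 ((U η 5).det * (U η 5).det)) :=
      htop.mul_const _
    have h2 := h1.eventually (lt_mem_nhds (mul_self_pos.mpr hD0))
    filter_upwards [h2, eventually_gt_atTop 0] with x hx hx0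
    have hxpow : 0 < x ^ (2 * d 5) := pow_pos hx0 _
    have : f (U η) x * (U η 5).det = (f (U η) x / x ^ (2 * d 5) * (U η 5).det) * x ^ (2 * d 5) := by
      field_simp
    rw [this]
    exact mul_pos hx hxpow
  obtain ⟨x, hx_sign, hx_gt⟩ := (hev1.and (eventually_gt_atTop (τ (Fin.last N)))).exists
  have hx_pos : 0 < x := (hpos _).trans hx_gt
  -- the extended abscissae
  refine ⟨η, Fin.snoc τ x, ?_, ?_, ?_, ?_⟩
  · -- strictly increasing
    intro i j hij
    induction j using Fin.lastCases with
    | last =>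
      induction i using Fin.lastCases with
      | last => exact absurd hij (lt_irrefl _)
      | cast i =>
        simp only [Fin.snoc_castSucc, Fin.snoc_last]
        exact (hτ.monotone (Fin.le_last i)).trans_lt hx_gt
    | cast j =>
      induction i using Fin.lastCases with
      | last => exact absurd ((Fin.castSucc_lt_last j).trans hij) (lt_irrefl _)
      | cast i =>
        simp only [Fin.snoc_castSucc]
        exact hτ (Fin.castSucc_lt_castSucc_iff.mp hij)
  · -- positive
    intro j
    induction j using Fin.lastCases with
    | last => simp only [Fin.snoc_last]; exact hx_pos
    | cast j => simp only [Fin.snoc_castSucc]; exact hpos j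
  · -- non-vanishing
    intro j
    induction j using Fin.lastCases with
    | last =>
      simp only [Fin.snoc_last]
      intro h0
      have : f (U η) x = 0 := h0
      rw [this, zero_mul] at hx_sign; exact lt_irrefl _ hx_sign
    | cast j =>
      simp only [Fin.snoc_castSucc]
      intro h0
      have : f (U η) (τ j) = 0 := h0
      have := hpers' j
      rw [‹f (U η) (τ j) = 0›, mul_zero] at this; exact lt_irrefl _ this
  · -- alternation on the N+1 gaps
    intro j
    induction j using Fin.lastCases with
    | last =>
      -- the new gap (τ_N, x)
      have h1 : (Fin.snoc τ x : Fin (N + 2) → ℝ) (Fin.last N).castSucc = τ (Fin.last N) := Fin.snoc_castSucc _ _ _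
      have h2 : (Fin.snoc τ x : Fin (N + 2) → ℝ) (Fin.last N).succ = x := by
        rw [Fin.succ_last]; exact Fin.snoc_last _ _
      rw [h1, h2]
      exact neg_of_sign_chain (hpers' (Fin.last N)) hs_new hx_sign
    | cast j =>
      have h1 : (Fin.snoc τ x : Fin (N + 2) → ℝ) j.castSucc.castSucc = τ j.castSucc := Fin.snoc_castSucc _ _ _
      have h2 : (Fin.snoc τ x : Fin (N + 2) → ℝ) j.castSucc.succ = τ j.succ := by
        rw [Fin.succ_castSucc]; exact Fin.snoc_castSucc _ _ _
      rw [h1, h2]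
      exact neg_of_sign_transfer (hpers' j.castSucc) (hpers' j.succ) (halt j)

/-! ### One more alternation at the BOTTOM (un-null the lowest letter) -/

/-- **Bottom extension.**  Null non-zero bottom letter, strictly increasing exponents, `N+1` alternating abscissae with non-vanishing values ⇒ after
replacing `S₀` by `S₀ + η·1` for a suitable small `η`, there are `N+2` alternating abscissae (one more on the left). [this work] -/
theorem extend_bot (d : Fin 6 → ℕ) (hd : StrictMono d) (S : Fin 6 → Matrix (Fin 2) (Fin 2) ℝ)
    (h0 : (S 0).det = 0) (htr : (S 0).trace ≠ 0) {N : ℕ} (τ : Fin (N + 1) → ℝ) (hτ : StrictMono τ) (hpos : ∀ j, 0 < τ j)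
    (hne : ∀ j, (∑ l, τ j ^ d l • S l).det ≠ 0)
    (halt : ∀ j : Fin N, (∑ l, τ j.castSucc ^ d l • S l).det * (∑ l, τ j.succ ^ d l • S l).det < 0) :
    ∃ (η : ℝ) (τ' : Fin (N + 2) → ℝ), StrictMono τ' ∧ (∀ j, 0 < τ' j) ∧
      (∀ j, (∑ l, τ' j ^ d l • Function.update S 0 (S 0 + η • (1 : Matrix (Fin 2) (Fin 2) ℝ)) l).det ≠ 0) ∧
      (∀ j : Fin (N + 1),
        (∑ l, τ' j.castSucc ^ d l • Function.update S 0 (S 0 + η • (1 : Matrix (Fin 2) (Fin 2) ℝ)) l).det *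
        (∑ l, τ' j.succ ^ d l • Function.update S 0 (S 0 + η • (1 : Matrix (Fin 2) (Fin 2) ℝ)) l).det < 0) := by
  set f : (Fin 6 → Matrix (Fin 2) (Fin 2) ℝ) → ℝ → ℝ := fun T t => (∑ l, t ^ d l • T l).det with hf
  set U : ℝ → Fin 6 → Matrix (Fin 2) (Fin 2) ℝ := fun η => Function.update S 0 (S 0 + η • (1 : Matrix (Fin 2) (Fin 2) ℝ)) with hU
  set aF : ℝ := f S (τ 0) with haF
  have haF0 : aF ≠ 0 := hne _
  set ηof : ℝ → ℝ := fun s => -(s * ((S 0).trace * aF)) with hηof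
  have hη0 : Tendsto ηof (𝓝[>] 0) (𝓝 0) := by
    have : Tendsto ηof (𝓝 0) (𝓝 (ηof 0)) := by
      have hc : Continuous ηof := by rw [hηof]; fun_prop
      exact hc.tendsto 0
    rw [show ηof 0 = 0 by simp [hηof]] at this
    exact this.mono_left nhdsWithin_le_nhds
  have hpers : ∀ j, ∀ᶠ s in 𝓝[>] (0 : ℝ), 0 < f S (τ j) * f (U (ηof s)) (τ j) := by
    intro j
    have hc : Tendsto (fun η => f (U η) (τ j)) (𝓝 0) (𝓝 (f (U 0) (τ j))) :=
      (continuous_det_pencil_update d S 0 (τ j)).tendsto 0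
    have hU0 : f (U 0) (τ j) = f S (τ j) := by
      simp [hU, hf]
    rw [hU0] at hc
    have h2 : Tendsto (fun s => f S (τ j) * f (U (ηof s)) (τ j)) (𝓝[>] 0) (𝓝 (f S (τ j) * f S (τ j))) :=
      ((hc.comp (hη0)).const_mul _)
    exact h2.eventually (lt_mem_nhds (mul_self_pos.mpr (hne j)))
  have hnew : ∀ᶠ s in 𝓝[>] (0 : ℝ), (U (ηof s) 0).det * aF < 0 := by
    have hdet : ∀ s, (U (ηof s) 0).det * aF = s * (-( ((S 0).trace * aF) ^ 2) + s * (((S 0).trace * aF) ^ 2 * aF)) := by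
      intro s
      simp only [hU, Function.update_self, LacunarySymmetroidMatrixDescartes.TailGraft.det_add_smul_one_two, h0, hηof]
      ring
    simp_rw [hdet]
    have hq : Tendsto (fun s : ℝ => -( ((S 0).trace * aF) ^ 2) + s * (((S 0).trace * aF) ^ 2 * aF)) (𝓝[>] 0)
        (𝓝 (-( ((S 0).trace * aF) ^ 2) + 0 * (((S 0).trace * aF) ^ 2 * aF))) := by
      have hc : Continuous (fun s : ℝ => -( ((S 0).trace * aF) ^ 2) + s * (((S 0).trace * aF) ^ 2 * aF)) := by fun_prop
      exact (hc.tendsto 0).mono_left nhdsWithin_le_nhds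
    have hlim : -( ((S 0).trace * aF) ^ 2) + 0 * (((S 0).trace * aF) ^ 2 * aF) < 0 := by
      have : 0 < ((S 0).trace * aF) ^ 2 := by positivity
      linarith
    have hev := hq.eventually (gt_mem_nhds hlim)
    filter_upwards [hev, self_mem_nhdsWithin] with s hs hs0
    exact mul_neg_of_pos_of_neg hs0 hs
  obtain ⟨s, hs_pers, hs_new⟩ := (((Finset.eventually_all Finset.univ).mpr fun j _ => hpers j).and hnew).exists
  set η := ηof s with hηdef
  have hpers' : ∀ j, 0 < f S (τ j) * f (U η) (τ j) := fun j => hs_pers j (Finset.mem_univ j)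
  have hD0 : (U η 0).det ≠ 0 := by
    intro h0'; rw [h0', zero_mul] at hs_new; exact lt_irrefl _ hs_new
  -- a near-zero abscissa with the sign of det(U η 0)
  have hbot := tendsto_det_pencil_div_bot d hd (U η)
  have hev1 : ∀ᶠ x in 𝓝[>] (0 : ℝ), 0 < f (U η) x * (U η 0).det := by
    have h1 : Tendsto (fun x : ℝ => (f (U η) x / x ^ (2 * d 0)) * (U η 0).det) (𝓝[>] 0) (𝓝 ((U η 0).det * (U η 0).det)) :=
      hbot.mul_const _
    have h2 := h1.eventually (lt_mem_nhds (mul_self_pos.mpr hD0))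
    filter_upwards [h2, self_mem_nhdsWithin] with x hx hx0
    have hxpow : 0 < x ^ (2 * d 0) := pow_pos hx0 _
    have : f (U η) x * (U η 0).det = (f (U η) x / x ^ (2 * d 0) * (U η 0).det) * x ^ (2 * d 0) := by
      field_simp
    rw [this]
    exact mul_pos hx hxpow
  have hev2 : ∀ᶠ x in 𝓝[>] (0 : ℝ), x < τ 0 := nhdsWithin_le_nhds (Iio_mem_nhds (hpos 0))
  obtain ⟨x, ⟨hx_sign, hx_lt⟩, hx_pos⟩ := ((hev1.and hev2).and self_mem_nhdsWithin).exists
  refine ⟨η, Fin.cons x τ, ?_, ?_, ?_, ?_⟩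
  · -- strictly increasing
    intro i j hij
    induction i using Fin.cases with
    | zero =>
      induction j using Fin.cases with
      | zero => exact (lt_irrefl _ hij).elim
      | succ j =>
        simp only [Fin.cons_zero, Fin.cons_succ]
        exact hx_lt.trans_le (hτ.monotone (Fin.zero_le j))
    | succ i =>
      induction j using Fin.cases with
      | zero => exact absurd hij (not_lt.2 (Fin.zero_le _))
      | succ j =>
        simp only [Fin.cons_succ]
        exact hτ (Fin.succ_lt_succ_iff.1 hij)
  · intro j
    induction j using Fin.cases with
    | zero => simp only [Fin.cons_zero]; exact hx_pos
    | succ j => simp only [Fin.cons_succ]; exact hpos j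
  · intro j
    induction j using Fin.cases with
    | zero =>
      simp only [Fin.cons_zero]
      intro h0'
      have : f (U η) x = 0 := h0'
      rw [this, zero_mul] at hx_sign; exact lt_irrefl _ hx_sign
    | succ j =>
      simp only [Fin.cons_succ]
      intro h0'
      have hz : f (U η) (τ j) = 0 := h0'
      have := hpers' j
      rw [hz, mul_zero] at this; exact lt_irrefl _ this
  · intro j
    induction j using Fin.cases with
    | zero =>
      have h1 : (Fin.cons x τ : Fin (N + 2) → ℝ) (0 : Fin (N + 1)).castSucc = x := rfl
      have h2 : (Fin.cons x τ : Fin (N + 2) → ℝ) (0 : Fin (N + 1)).succ = τ 0 := rfl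
      rw [h1, h2, mul_comm]
      exact neg_of_sign_chain (hpers' 0) hs_new hx_sign
    | succ i =>
      have h1 : (Fin.cons x τ : Fin (N + 2) → ℝ) i.succ.castSucc = τ i.castSucc := by
        rw [← Fin.succ_castSucc]; exact Fin.cons_succ _ _ _
      have h2 : (Fin.cons x τ : Fin (N + 2) → ℝ) i.succ.succ = τ i.succ := Fin.cons_succ _ _ _
      rw [h1, h2]
      exact neg_of_sign_transfer (hpers' i.castSucc) (hpers' i.succ) (halt i)

end Summit.ValiantsHypothesis.ValiantsHypothesis.Theorems.LacunarySymmetroidMatrixDescartes.NullEnd
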